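import Summits.QuantumFields.YangMills.Theorems.BalabanUVNodesK0Stub1TransposesByDualiser
import Summits.QuantumFields.YangMills.Theorems.BalabanUVNodesK0Stub1ChartDAnalytic
import Summits.QuantumFields.YangMills.Theorems.BalabanUVNodesK0Stub1RecordAveragingRightInverse
import HarnessLib

/-!
# K0⁷ STUB 1 (`stub_prop8StepCoP13`), sub-target S4b «the (δ∕δA′)V pieces at objects» — THE CHART BLOCK OF THE SECT. F CAPSTONE AT THE RECORD, part 3:
# **JUNCTION** — at every torus `P`, height `k`, admissible nested family and P2's flat `H₀`: the operators `Q = Qlin`, `H`, `Qᵗ`, `Hᵗ`, the TRUE chart `D(·)` with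
# `𝔇 := fderiv D` and `𝔇(A′)ᵗ`, delivered in the binder shapes of `K0Stub1SectFWSlotOneLevel.exists_sectF_W_levOf` with `hQt hHt hD hDt hDdiff hDtdiff h55` and the
# sup half of `h57` DISCHARGED — after this file the W-slot `hWq` of Sect. F's `W = (δ∕δA′)V` at the record's true constraint displays LETTERS only

Cell `pub-ymgap`, width seat `pub-ymgap-k0-s1-w2` g3 (CLAIM-1 (iii), bus 2026-08-28 04:54Z).  `--kind proof --supports stmt-QuantumFields-20541 --as helper`;
count-neutral.  [15] = [Balaban1985Variational]; [B6] = [Balaban1984PropagatorsII].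

WHY.  The capstone (p596653) is Prop. 4 for Sect. F's `W` at the Setup torus with the chart `D`, its derivative family `𝔇`, the transposes and their holomorphy as DATA.
Parts 1–2 of this block (this seat, g3) give transposes BY FORMULA for any `Q, H, 𝔇` and the ANALYTICITY of every solution family of (49); dag-n07-w2's S2 files give the
true chart at the record (`N07ChartDOfRecord`, `N07ChartLogAnalytic`, `N07ChartDDerivative`); dag k0-s1-w1 gives the right inverse `H` of the true linearisation from P2's
flat `H₀` (`K0Stub1RecordAveragingRightInverse.exists_rightInverse_chartLog_of_flatH`).  THIS FILE is the junction: ONE theorem per reading, no new mathematics.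

WHAT IS PROVED (sorry-free; no definition; axioms standard; fibre `M_n(ℂ)`).
* §1 ★★ `chartBlock_of_solution` — GENERIC IN THE SOLUTION FAMILY: for the binders of part 2 §2 (any ℂ-linear right inverse `H` with the (46) letter, the `ε`-window
  `18C₂B₀ε ≤ 1`, `64ε ≤ R⋆`, ANY `Dfun` with (55) + (49) on the sup-ball) and the pairing data of part 1 §3 (`BE` = (27) verbatim, block trace pairing `B`, dualiser `ρ`):
  with `𝔇 := fderiv ℂ Dfun` there is `Dt` such that, IN THE CAPSTONE's SHAPES (two-size ball of radius `ε`, block weight `1`, `C_D = 4C₂`): `hD`, `hDt` (every `A′`), `hDdiff`,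
  `h𝔇diff`, `hDtdiff`, `h55`, the sup half of `h57` with `ℓ = 1 + 4B₀C₂ε`, and `ContDiffOn ℂ ω Dfun` on the sup-ball.  Both dag-n07-w2 selectors (`exists_chartD_of_rightInverse`'s,
  `exists_chartD_hasFDerivAt`'s) are instances.
* §2 ★★★ `exists_chartBlock_of_flatH` — AT P2's FLAT `H₀` (`IsFlatH P k D H₀`, `HSupLetterG P k D w H₀ B₀`; `Adm22 D R′ M`, `2L ≤ R′`, `1 ≤ M`): `∃ H Qt Ht Dfun Dt` with `H` a
  CONTINUOUS linear right inverse of `Qlin` carrying the (46) letter `B₀(1+2ℓ)(1+2ℓ+2ℓL)`, `hQt`∕`hHt` for `Q := Qlin`, and everything of §1 for the analytic selector of part 2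
  §3 — (55), (49), (48) at every point of the sup-ball included.  (A6: the `ε`-window is inhabited by dag-n07-w2's `N07ChartDDerivative.exists_eps_chartDDeriv`.)
HONEST SCOPE.  Junction of landed theorems; the LETTERS of the capstone stay displayed: (3.132) `O₁` for `M = (QGQ*)⁻¹ − a` (k0-s1-w1's `M_V`, `hM` = p598821), `q₀` (`Qᵗ`),
`θ₀` = (73)ᵀ, `h₀` = (46)ᵀ, `q` (the average), the GRADIENT half (58) of `ℓ` (needs the ∇-row of (46) for the corrected `H`, not exported by k0-s1-w1's file) — the d = 4
port's ∕ S2's ∕ `B11Eq73KernelDecay`'s business; (73) at norm level is dag-n07-w2's `N07ChartDDerivative` (same `D(·)` on the ball by `chartD_unique`).  Nothing of [15]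
Sects. D–F asserted; `stub_prop8StepCoP13` ∕ K0⁷ NOT closed; N07 NOT discharged; counts unmoved (28∕28 · 5∕27); one finite 𝕋⁴ programme at fixed ε — R4 closes the
conditional finite-𝕋⁴ rung `BalabanLadder.UV` only, never the summit; the YM mass gap (Clay) is NOT proved by any of this; nothing continuum ∕ ℝ⁴ ∕ OS.
No `sorry`, no `def`, no `instance`, no `notation`.

References: [15] (27) p.282, (45)–(50) p.285, (55)–(58) pp.286–287, (63)–(73) pp.287–289, Prop. 3 p.289, Prop. 4 (97)–(98) pp.292–293, (157)–(158) p.302;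
[B6] (2.35) p.228, Cor. 2.8 p.249.
-/

noncomputable section

open scoped BigOperators Matrix.Norms.L2Operator Topology ContDiff
open NormedSpace Metric Set Filter

namespace Summit.QuantumFields.YangMills.Theorems.K0Stub1SectFChartBlockAtRecord

open Literature.MathematicalPhysics.QuantumFieldTheory.Balaban1983to89
open Literature.MathematicalPhysics.QuantumFieldTheory.Balaban1983to89.B6SectADomainsV1 (Domains)
open Literature.MathematicalPhysics.QuantumFieldTheory.Balaban1983to89.B6SectAOperatorsV1 (BondIdx)
open B9Eq39Adjoint (bondPair)
open Summit.QuantumFields.YangMills.Theorems.FlatCubeOpsText (Adm22)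
open Summit.QuantumFields.YangMills.Theorems.K0FlatCubeOpsTextP (IsLevWeight IsFlatH HSupLetterG)
open Summit.QuantumFields.YangMills.Theorems.Prop8Chart (chartLog)
open Summit.QuantumFields.YangMills.BalabanUVNodes.N07ChartDOfRecord (size_chartA_le)
open Summit.QuantumFields.YangMills.Theorems.K0Stub1TransposesByDualiser (exists_transposeCLM exists_capstoneTransposes)
open Summit.QuantumFields.YangMills.Theorems.K0Stub1ChartDAnalytic (contDiffOn_chartD hasFDerivAt_chartD differentiableOn_fderiv_chartD
  isOpen_weightedBall exists_analytic_chartD_of_rightInverse window_of_h18)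
open Summit.QuantumFields.YangMills.Theorems.K0Stub1RecordAveragingRightInverse (exists_rightInverse_chartLog_of_flatH)
open Summit.QuantumFields.YangMills.Theorems.K0Stub1PairingsAtExtensions (bondPair_PBond_eq_sum)

variable {P : Params} {n : Type*} [Fintype n] [DecidableEq n] [Nonempty n]

/-! ## §1  ★★ The chart block in the capstone's shapes, generic in the solution family -/

/-- ★★ **THE CHART BLOCK OF THE CAPSTONE FOR ANY SOLUTION FAMILY OF (49).**  Binders: part 2 §2's (torus `P`, height `k`, `Adm22 D R′ M` with `2L ≤ R′`, `1 ≤ M`,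
`D.k = k`, weights `IsLevWeight P k D w`, ℂ-linear right inverse `H` of `Qlin` with the weighted (46) letter `B₀`, `ε > 0`, `18C₂B₀ε ≤ 1`, `64ε ≤ R⋆`, a map `Dfun` with (55) +
(49) on the sup-ball) and part 1 §3's pairing data (`L ≠ 0` automatic; `τ`, dualiser `ρ` with `τ(ρℓ·X) = ℓX`; `BE` = (27) in the capstone's letter; block trace pairing
`B`).  CONCLUSION, with `𝔇 := fderiv ℂ Dfun`: there is `Dt : fields → (blocks →L fields)` such that — in the SHAPES of `K0Stub1SectFWSlotOneLevel.exists_sectF_W_levOf` with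
`a₃ := ε`, block weight `1`, `C_D := 4C₂` — `hD` (on the two-size ball), `hDt` (every `A′`), `hDdiff`, `DifferentiableOn ℂ 𝔇`, `hDtdiff` (two-size ball), `h55`, the sup half of
`h57` with `ℓ := 1 + B₀·4C₂·ε`, and `ContDiffOn ℂ ω Dfun` on the sup-ball.
[cite: Balaban1985Variational, (47)-(50) p.285, (55)-(57) p.286, (63)-(73) pp.287-289, Prop. 3 p.289, Prop. 4 p.292, (157)-(158) p.302] -/
theorem chartBlock_of_solution (k : ℕ) {R' M : ℕ} (hR'L : 2 * P.L ≤ R') (hM : 1 ≤ M) (D : Domains P) (hDk : D.k = k) (hAdm : Adm22 D R' M)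
    {w : ℕ → PBond P 0 → ℝ} (hw : IsLevWeight P k D w)
    (H : (BondIdx D → Matrix n n ℂ) →ₗ[ℂ] (PBond P 0 → Matrix n n ℂ))
    (hHinv : ∀ X, (fderiv ℂ (chartLog (((P.L : ℝ)⁻¹) ^ k) D : (PBond P 0 → Matrix n n ℂ) → BondIdx D → Matrix n n ℂ) 0) (H X) = X)
    {B₀ : ℝ} (hB₀ : 0 ≤ B₀)
    (hHB : ∀ (X : BondIdx D → Matrix n n ℂ) (t : ℝ), 0 ≤ t → (∀ i, ‖X i‖ ≤ t) → ∀ b, w 1 b * ‖H X b‖ ≤ B₀ * t)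
    {ε : ℝ} (hε : 0 < ε)
    (h18 : 18 * (960 * (((P.d + 2) * P.L : ℕ) : ℝ) * (P.L : ℝ) / (12800 * (((P.d + 2) * P.L : ℕ) : ℝ) ^ 2 * (P.L : ℝ))⁻¹) * B₀ * ε ≤ 1)
    (h2 : 64 * ε ≤ (12800 * (((P.d + 2) * P.L : ℕ) : ℝ) ^ 2 * (P.L : ℝ))⁻¹)
    (Dfun : (PBond P 0 → Matrix n n ℂ) → (BondIdx D → Matrix n n ℂ))
    (h55 : ∀ A' : PBond P 0 → Matrix n n ℂ, (∀ b, w 1 b * ‖A' b‖ < ε) →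
      ∀ ρ : ℝ, 0 ≤ ρ → (∀ b, w 1 b * ‖A' b‖ ≤ ρ) →
        ∀ i, ‖Dfun A' i‖ ≤ 4 * (960 * (((P.d + 2) * P.L : ℕ) : ℝ) * (P.L : ℝ) / (12800 * (((P.d + 2) * P.L : ℕ) : ℝ) ^ 2 * (P.L : ℝ))⁻¹) * ρ ^ 2)
    (h49 : ∀ A' : PBond P 0 → Matrix n n ℂ, (∀ b, w 1 b * ‖A' b‖ < ε) →
      chartLog (((P.L : ℝ)⁻¹) ^ k) D (A' - H (Dfun A')) -
        (fderiv ℂ (chartLog (((P.L : ℝ)⁻¹) ^ k) D : (PBond P 0 → Matrix n n ℂ) → BondIdx D → Matrix n n ℂ) 0) (A' - H (Dfun A')) = Dfun A')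
    -- the pairing data of part 1
    (τ : Matrix n n ℂ →L[ℂ] ℂ) (ρ : (Matrix n n ℂ →L[ℂ] ℂ) →L[ℂ] Matrix n n ℂ) (hρ : ∀ (ℓ : Matrix n n ℂ →L[ℂ] ℂ) (X : Matrix n n ℂ), τ (ρ ℓ * X) = ℓ X)
    (BE : (PBond P 0 → Matrix n n ℂ) →L[ℂ] (PBond P 0 → Matrix n n ℂ) →L[ℂ] ℂ)
    (hBE : ∀ Y δ : PBond P 0 → Matrix n n ℂ, BE Y δ =
      bondPair (((P.L : ℝ))⁻¹ ^ k) P.d (τ : Matrix n n ℂ →ₗ[ℂ] ℂ) (fun μ x => Y ⟨x, μ⟩) (fun μ x => δ ⟨x, μ⟩))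
    (B : (BondIdx D → Matrix n n ℂ) →L[ℂ] (BondIdx D → Matrix n n ℂ) →L[ℂ] ℂ) (hB : ∀ X X' : BondIdx D → Matrix n n ℂ, B X X' = ∑ t, τ (X t * X' t)) :
    ∃ Dt : (PBond P 0 → Matrix n n ℂ) → ((BondIdx D → Matrix n n ℂ) →L[ℂ] (PBond P 0 → Matrix n n ℂ)),
      -- hD
      (∀ A' : PBond P 0 → Matrix n n ℂ, (∀ b, w 1 b * ‖A' b‖ < ε) →
        (∀ (b : PBond P 0) (ν : Fin P.d), w 2 b * (P.L : ℝ) ^ k * ‖A' ⟨b.src.shift ν, b.dir⟩ - A' b‖ < ε) →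
        HasFDerivAt Dfun (fderiv ℂ Dfun A') A') ∧
      -- hDt
      (∀ (A' : PBond P 0 → Matrix n n ℂ) X δ, BE (Dt A' X) δ = B X (fderiv ℂ Dfun A' δ)) ∧
      -- hDdiff, h𝔇diff, hDtdiff on the two-size ball
      DifferentiableOn ℂ Dfun {Y : PBond P 0 → Matrix n n ℂ | (∀ b, w 1 b * ‖Y b‖ < ε) ∧
        ∀ (b : PBond P 0) (ν : Fin P.d), w 2 b * (P.L : ℝ) ^ k * ‖Y ⟨b.src.shift ν, b.dir⟩ - Y b‖ < ε} ∧
      DifferentiableOn ℂ (fderiv ℂ Dfun) {Y : PBond P 0 → Matrix n n ℂ | (∀ b, w 1 b * ‖Y b‖ < ε) ∧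
        ∀ (b : PBond P 0) (ν : Fin P.d), w 2 b * (P.L : ℝ) ^ k * ‖Y ⟨b.src.shift ν, b.dir⟩ - Y b‖ < ε} ∧
      DifferentiableOn ℂ Dt {Y : PBond P 0 → Matrix n n ℂ | (∀ b, w 1 b * ‖Y b‖ < ε) ∧
        ∀ (b : PBond P 0) (ν : Fin P.d), w 2 b * (P.L : ℝ) ^ k * ‖Y ⟨b.src.shift ν, b.dir⟩ - Y b‖ < ε} ∧
      -- h55 (block weight 1, `C_D = 4C₂`)
      (∀ (A' : PBond P 0 → Matrix n n ℂ) (r : ℝ), (∀ b, w 1 b * ‖A' b‖ ≤ r) →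
        (∀ (b : PBond P 0) (ν : Fin P.d), w 2 b * (P.L : ℝ) ^ k * ‖A' ⟨b.src.shift ν, b.dir⟩ - A' b‖ ≤ r) → r < ε →
        ∀ i, (1 : ℝ) * ‖Dfun A' i‖ ≤
          (4 * (960 * (((P.d + 2) * P.L : ℕ) : ℝ) * (P.L : ℝ) / (12800 * (((P.d + 2) * P.L : ℕ) : ℝ) ^ 2 * (P.L : ℝ))⁻¹)) * r ^ 2) ∧
      -- (57), sup half, `ℓ = 1 + B₀·4C₂·ε`
      (∀ (A' : PBond P 0 → Matrix n n ℂ) (r : ℝ), (∀ b, w 1 b * ‖A' b‖ ≤ r) → r < ε →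
        ∀ b, w 1 b * ‖(A' - H (Dfun A')) b‖ ≤
          (1 + B₀ * (4 * (960 * (((P.d + 2) * P.L : ℕ) : ℝ) * (P.L : ℝ) / (12800 * (((P.d + 2) * P.L : ℕ) : ℝ) ^ 2 * (P.L : ℝ))⁻¹)) * ε) * r) ∧
      -- analyticity on the sup-ball
      ContDiffOn ℂ ω Dfun {Y : PBond P 0 → Matrix n n ℂ | ∀ b, w 1 b * ‖Y b‖ < ε} := by
  -- letters
  have hL0 : (0 : ℝ) < P.L := by exact_mod_cast P.L_pos
  have hL : (P.L : ℝ) ≠ 0 := hL0.ne'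
  have hℓ1 : (1 : ℝ) ≤ (((P.d + 2) * P.L : ℕ) : ℝ) := by
    exact_mod_cast Nat.one_le_iff_ne_zero.mpr (Nat.mul_ne_zero (by omega) (by have := P.hL.2; omega))
  have hC₂ : 0 ≤ 960 * (((P.d + 2) * P.L : ℕ) : ℝ) * (P.L : ℝ) / (12800 * (((P.d + 2) * P.L : ℕ) : ℝ) ^ 2 * (P.L : ℝ))⁻¹ := by positivity
  have hwpos : ∀ b, 0 < w 1 b := fun b => by rw [hw 1 b, pow_one]; positivity
  -- the sub-ball inclusion
  have hsub : {Y : PBond P 0 → Matrix n n ℂ | (∀ b, w 1 b * ‖Y b‖ < ε) ∧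
      ∀ (b : PBond P 0) (ν : Fin P.d), w 2 b * (P.L : ℝ) ^ k * ‖Y ⟨b.src.shift ν, b.dir⟩ - Y b‖ < ε} ⊆
      {Y : PBond P 0 → Matrix n n ℂ | ∀ b, w 1 b * ‖Y b‖ < ε} := fun Y hY => hY.1
  -- part 2: regularity of `Dfun`
  have hcd := contDiffOn_chartD k hR'L hM D hDk hAdm hw H hHinv hB₀ hHB hε h18 h2 Dfun h55 h49
  have hDd : DifferentiableOn ℂ Dfun {Y : PBond P 0 → Matrix n n ℂ | ∀ b, w 1 b * ‖Y b‖ < ε} := hcd.differentiableOn (by simp)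
  have h𝔇d := differentiableOn_fderiv_chartD k hR'L hM D hDk hAdm hw H hHinv hB₀ hHB hε h18 h2 Dfun h55 h49
  -- part 1: transposes by formula (only `Dt` is needed here)
  obtain ⟨-, -, Dt, -, -, hDt, hDtreg, -, -, -⟩ := exists_capstoneTransposes (β := BondIdx D) k hL τ ρ hρ BE hBE B hB
    (fderiv ℂ (chartLog (((P.L : ℝ)⁻¹) ^ k) D : (PBond P 0 → Matrix n n ℂ) → BondIdx D → Matrix n n ℂ) 0)
    (LinearMap.toContinuousLinearMap H) (fderiv ℂ Dfun)
  refine ⟨Dt, fun A' hA' _ => hasFDerivAt_chartD k hR'L hM D hDk hAdm hw H hHinv hB₀ hHB hε h18 h2 Dfun h55 h49 A' hA', hDt,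
    hDd.mono hsub, h𝔇d.mono hsub, (hDtreg _ h𝔇d).mono hsub, fun A' r hA' _ hr i => ?_, fun A' r hA' hr b => ?_, hcd⟩
  · -- (55) at the size `max r 0`
    rw [one_mul]
    have hA'ε : ∀ b, w 1 b * ‖A' b‖ < ε := fun b => (hA' b).trans_lt hr
    have h := h55 A' hA'ε (max r 0) (le_max_right _ _) (fun b => (hA' b).trans (le_max_left _ _)) i
    refine h.trans (mul_le_mul_of_nonneg_left ?_ (by positivity))
    rcases le_or_gt 0 r with hr0 | hr0
    · rw [max_eq_left hr0]
    · rw [max_eq_right hr0.le, zero_pow two_ne_zero]; exact sq_nonneg r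
  · -- (57), sup half
    have hr0 : 0 ≤ r := le_trans (mul_nonneg (hwpos b).le (norm_nonneg _)) (hA' b)
    have hA'ε : ∀ b, w 1 b * ‖A' b‖ < ε := fun b => (hA' b).trans_lt hr
    have hDr := h55 A' hA'ε r hr0 hA'
    have h := size_chartA_le hwpos H hC₂ hB₀ hHB hA' hDr b
    refine h.trans ?_
    have : r + B₀ * (4 * (960 * (((P.d + 2) * P.L : ℕ) : ℝ) * (P.L : ℝ) / (12800 * (((P.d + 2) * P.L : ℕ) : ℝ) ^ 2 * (P.L : ℝ))⁻¹) * r ^ 2)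
        = (1 + B₀ * (4 * (960 * (((P.d + 2) * P.L : ℕ) : ℝ) * (P.L : ℝ) / (12800 * (((P.d + 2) * P.L : ℕ) : ℝ) ^ 2 * (P.L : ℝ))⁻¹)) * r) * r := by
      ring
    rw [this]
    apply mul_le_mul_of_nonneg_right _ hr0
    have : B₀ * (4 * (960 * (((P.d + 2) * P.L : ℕ) : ℝ) * (P.L : ℝ) / (12800 * (((P.d + 2) * P.L : ℕ) : ℝ) ^ 2 * (P.L : ℝ))⁻¹)) * r ≤
        B₀ * (4 * (960 * (((P.d + 2) * P.L : ℕ) : ℝ) * (P.L : ℝ) / (12800 * (((P.d + 2) * P.L : ℕ) : ℝ) ^ 2 * (P.L : ℝ))⁻¹)) * ε :=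
      mul_le_mul_of_nonneg_left hr.le (by positivity)
    linarith

/-! ## §2  ★★★ At P2's flat `H₀`: the whole operator∕chart block of the capstone, letters displayed -/

/-- ★★★ **THE OPERATOR∕CHART BLOCK OF THE SECT. F CAPSTONE AT THE RECORD's TRUE CONSTRAINT, FROM P2's FLAT `H₀`.**  Binders: torus `P`, height `k`, `Adm22 D R′ M`
(`2L ≤ R′`, `1 ≤ M`, `D.k = k`), weights `IsLevWeight P k D w`, P2's flat operator `H₀` (`IsFlatH P k D H₀`) with its guarded sup letter `HSupLetterG P k D w H₀ B₀` (dag k0-s1-w3's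
generic schemas; content = [B6] Cor. 2.8), `ε > 0` with `18C₂B₀′ε ≤ 1`, `64ε ≤ R⋆` (`B₀′ = B₀(1+2ℓ)(1+2ℓ+2ℓL)`), and the pairing data (`τ`, dualiser `ρ`, `BE` = (27) verbatim,
block trace pairing `B`).  THEN there are: a CONTINUOUS linear right inverse `H` of `Qlin = D(chartLog η D)(0)` with the weighted (46) letter `B₀′` (dag k0-s1-w1's
`exists_rightInverse_chartLog_of_flatH`), transposes `Qt`, `Ht` with the capstone's `hQt`, `hHt` for `Q := Qlin` (part 1), the ANALYTIC chart `Dfun` (part 2 §3) with (55),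
(49), (48) at every point of the sup-ball, and `Dt` with everything of §1 (`hD hDt hDdiff h𝔇diff hDtdiff h55`, sup half of `h57`).
[cite: Balaban1985Variational, (27) p.282, (45)-(50) p.285, (55)-(57) p.286, Prop. 3 p.289, Prop. 4 (97)-(98) pp.292-293, (157)-(158) p.302; Balaban1984PropagatorsII, (2.35) p.228, Cor. 2.8 p.249] -/
theorem exists_chartBlock_of_flatH (k : ℕ) {R' M : ℕ} (hR'L : 2 * P.L ≤ R') (hM : 1 ≤ M) (D : Domains P) (hDk : D.k = k) (hAdm : Adm22 D R' M)
    {w : ℕ → PBond P 0 → ℝ} (hw : IsLevWeight P k D w) (H₀ : (BondIdx D → ℝ) →ₗ[ℝ] (PBond P 0 → ℝ)) (hH₀ : IsFlatH P k D H₀)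
    {B₀ : ℝ} (hB₀ : 0 ≤ B₀) (hsup : HSupLetterG P k D w H₀ B₀) {ε : ℝ} (hε : 0 < ε)
    (h18 : 18 * (960 * (((P.d + 2) * P.L : ℕ) : ℝ) * (P.L : ℝ) / (12800 * (((P.d + 2) * P.L : ℕ) : ℝ) ^ 2 * (P.L : ℝ))⁻¹) *
      (B₀ * ((1 + 2 * ((P.d + 2) * P.L : ℕ)) * (1 + 2 * ((P.d + 2) * P.L : ℕ) + 2 * ((P.d + 2) * P.L : ℕ) * P.L))) * ε ≤ 1)
    (h2 : 64 * ε ≤ (12800 * (((P.d + 2) * P.L : ℕ) : ℝ) ^ 2 * (P.L : ℝ))⁻¹)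
    (τ : Matrix n n ℂ →L[ℂ] ℂ) (ρ : (Matrix n n ℂ →L[ℂ] ℂ) →L[ℂ] Matrix n n ℂ) (hρ : ∀ (ℓ : Matrix n n ℂ →L[ℂ] ℂ) (X : Matrix n n ℂ), τ (ρ ℓ * X) = ℓ X)
    (BE : (PBond P 0 → Matrix n n ℂ) →L[ℂ] (PBond P 0 → Matrix n n ℂ) →L[ℂ] ℂ)
    (hBE : ∀ Y δ : PBond P 0 → Matrix n n ℂ, BE Y δ =
      bondPair (((P.L : ℝ))⁻¹ ^ k) P.d (τ : Matrix n n ℂ →ₗ[ℂ] ℂ) (fun μ x => Y ⟨x, μ⟩) (fun μ x => δ ⟨x, μ⟩))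
    (B : (BondIdx D → Matrix n n ℂ) →L[ℂ] (BondIdx D → Matrix n n ℂ) →L[ℂ] ℂ) (hB : ∀ X X' : BondIdx D → Matrix n n ℂ, B X X' = ∑ t, τ (X t * X' t)) :
    let η : ℝ := ((P.L : ℝ)⁻¹) ^ k
    let C₂ : ℝ := 960 * (((P.d + 2) * P.L : ℕ) : ℝ) * (P.L : ℝ) / (12800 * (((P.d + 2) * P.L : ℕ) : ℝ) ^ 2 * (P.L : ℝ))⁻¹
    let B₀' : ℝ := B₀ * ((1 + 2 * ((P.d + 2) * P.L : ℕ)) * (1 + 2 * ((P.d + 2) * P.L : ℕ) + 2 * ((P.d + 2) * P.L : ℕ) * P.L))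
    let Qlin := (fderiv ℂ (chartLog η D : (PBond P 0 → Matrix n n ℂ) → BondIdx D → Matrix n n ℂ) 0)
    ∃ (H : (BondIdx D → Matrix n n ℂ) →L[ℂ] (PBond P 0 → Matrix n n ℂ))
      (Qt : (BondIdx D → Matrix n n ℂ) →L[ℂ] (PBond P 0 → Matrix n n ℂ)) (Ht : (PBond P 0 → Matrix n n ℂ) →L[ℂ] (BondIdx D → Matrix n n ℂ))
      (Dfun : (PBond P 0 → Matrix n n ℂ) → (BondIdx D → Matrix n n ℂ))
      (Dt : (PBond P 0 → Matrix n n ℂ) → ((BondIdx D → Matrix n n ℂ) →L[ℂ] (PBond P 0 → Matrix n n ℂ))),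
      -- `H`: right inverse with the (46) letter
      (∀ X, Qlin (H X) = X) ∧
      (∀ (X : BondIdx D → Matrix n n ℂ) (t : ℝ), 0 ≤ t → (∀ i, ‖X i‖ ≤ t) → ∀ b, w 1 b * ‖H X b‖ ≤ B₀' * t) ∧
      -- `hQt`, `hHt`
      (∀ X δ, BE (Qt X) δ = B X (Qlin δ)) ∧
      (∀ Z X, BE Z (H X) = B (Ht Z) X) ∧
      -- the chart: (55), (49), (48) on the sup-ball
      (∀ A' : PBond P 0 → Matrix n n ℂ, (∀ b, w 1 b * ‖A' b‖ < ε) →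
        (∀ ρ' : ℝ, 0 ≤ ρ' → (∀ b, w 1 b * ‖A' b‖ ≤ ρ') → ∀ i, ‖Dfun A' i‖ ≤ 4 * C₂ * ρ' ^ 2) ∧
        chartLog η D (A' - H (Dfun A')) - Qlin (A' - H (Dfun A')) = Dfun A' ∧
        chartLog η D (A' - H (Dfun A')) = Qlin A') ∧
      -- hD
      (∀ A' : PBond P 0 → Matrix n n ℂ, (∀ b, w 1 b * ‖A' b‖ < ε) →
        (∀ (b : PBond P 0) (ν : Fin P.d), w 2 b * (P.L : ℝ) ^ k * ‖A' ⟨b.src.shift ν, b.dir⟩ - A' b‖ < ε) →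
        HasFDerivAt Dfun (fderiv ℂ Dfun A') A') ∧
      -- hDt
      (∀ (A' : PBond P 0 → Matrix n n ℂ) X δ, BE (Dt A' X) δ = B X (fderiv ℂ Dfun A' δ)) ∧
      -- hDdiff, h𝔇diff, hDtdiff
      DifferentiableOn ℂ Dfun {Y : PBond P 0 → Matrix n n ℂ | (∀ b, w 1 b * ‖Y b‖ < ε) ∧
        ∀ (b : PBond P 0) (ν : Fin P.d), w 2 b * (P.L : ℝ) ^ k * ‖Y ⟨b.src.shift ν, b.dir⟩ - Y b‖ < ε} ∧
      DifferentiableOn ℂ (fderiv ℂ Dfun) {Y : PBond P 0 → Matrix n n ℂ | (∀ b, w 1 b * ‖Y b‖ < ε) ∧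
        ∀ (b : PBond P 0) (ν : Fin P.d), w 2 b * (P.L : ℝ) ^ k * ‖Y ⟨b.src.shift ν, b.dir⟩ - Y b‖ < ε} ∧
      DifferentiableOn ℂ Dt {Y : PBond P 0 → Matrix n n ℂ | (∀ b, w 1 b * ‖Y b‖ < ε) ∧
        ∀ (b : PBond P 0) (ν : Fin P.d), w 2 b * (P.L : ℝ) ^ k * ‖Y ⟨b.src.shift ν, b.dir⟩ - Y b‖ < ε} ∧
      -- h55
      (∀ (A' : PBond P 0 → Matrix n n ℂ) (r : ℝ), (∀ b, w 1 b * ‖A' b‖ ≤ r) →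
        (∀ (b : PBond P 0) (ν : Fin P.d), w 2 b * (P.L : ℝ) ^ k * ‖A' ⟨b.src.shift ν, b.dir⟩ - A' b‖ ≤ r) → r < ε →
        ∀ i, (1 : ℝ) * ‖Dfun A' i‖ ≤ (4 * C₂) * r ^ 2) ∧
      -- (57), sup half
      (∀ (A' : PBond P 0 → Matrix n n ℂ) (r : ℝ), (∀ b, w 1 b * ‖A' b‖ ≤ r) → r < ε →
        ∀ b, w 1 b * ‖(A' - H (Dfun A')) b‖ ≤ (1 + B₀' * (4 * C₂) * ε) * r) ∧
      ContDiffOn ℂ ω Dfun {Y : PBond P 0 → Matrix n n ℂ | ∀ b, w 1 b * ‖Y b‖ < ε} := by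
  intro η C₂ B₀' Qlin
  have hL0 : (0 : ℝ) < P.L := by exact_mod_cast P.L_pos
  have hL : (P.L : ℝ) ≠ 0 := hL0.ne'
  have hRM : 2 * P.L ≤ R' * M + 1 := by have : R' ≤ R' * M := Nat.le_mul_of_pos_right R' hM; omega
  have hB₀' : 0 ≤ B₀' := by positivity
  -- dag k0-s1-w1's right inverse of the true linearisation
  obtain ⟨Hl, hHinv, hHB⟩ := exists_rightInverse_chartLog_of_flatH (n := n) k D hDk hAdm hRM w hw H₀ hH₀ hB₀ hsup
  -- part 2 §3: the analytic selector
  obtain ⟨Dfun, hcd, h𝔇d, hpt⟩ := exists_analytic_chartD_of_rightInverse (n := n) k hR'L hM D hDk hAdm hw Hl hHinv hB₀' hHB hε h18 h2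
  have h55 : ∀ A' : PBond P 0 → Matrix n n ℂ, (∀ b, w 1 b * ‖A' b‖ < ε) →
      ∀ ρ' : ℝ, 0 ≤ ρ' → (∀ b, w 1 b * ‖A' b‖ ≤ ρ') → ∀ i, ‖Dfun A' i‖ ≤ 4 * C₂ * ρ' ^ 2 := fun A' hA' => (hpt A' hA').1
  have h49 : ∀ A' : PBond P 0 → Matrix n n ℂ, (∀ b, w 1 b * ‖A' b‖ < ε) →
      chartLog η D (A' - Hl (Dfun A')) - Qlin (A' - Hl (Dfun A')) = Dfun A' := fun A' hA' => (hpt A' hA').2.1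
  -- §1 for this family
  obtain ⟨Dt, hD, hDt, hDd, h𝔇d', hDtd, h55', h57, -⟩ := chartBlock_of_solution (n := n) k hR'L hM D hDk hAdm hw Hl hHinv hB₀' hHB hε h18 h2 Dfun h55 h49
    τ ρ hρ BE hBE B hB
  -- part 1: `Qt`, `Ht` for `Q := Qlin`, `H := Hl` (as a continuous map)
  obtain ⟨Qt, Ht, -, hQt, hHt, -, -, -, -, -⟩ := exists_capstoneTransposes (β := BondIdx D) k hL τ ρ hρ BE hBE B hB Qlin
    (LinearMap.toContinuousLinearMap Hl) (fderiv ℂ Dfun)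
  refine ⟨LinearMap.toContinuousLinearMap Hl, Qt, Ht, Dfun, Dt, hHinv, hHB, hQt, hHt,
    fun A' hA' => ⟨(hpt A' hA').1, (hpt A' hA').2.1, (hpt A' hA').2.2.1⟩, hD, hDt, hDd, h𝔇d', hDtd, h55', h57, hcd⟩

-- A6: the `ε`-window of §2 is inhabited by dag-n07-w2's `N07ChartDDerivative.exists_eps_chartDDeriv` (same shape `18C₂B₀′ε ≤ 1 ∧ 64ε ≤ R⋆`; landed p606148),
-- not restated here.

end Summit.QuantumFields.YangMills.Theorems.K0Stub1SectFChartBlockAtRecord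

end
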